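import Mathlib
import Summits.Ventures.HodgeRepro.Tier4.Target
import Summits.Ventures.HodgeRepro.Tier4.Common.TargetBall
import Summits.Ventures.HodgeRepro.Tier4.Line3.Defs
import Summits.Ventures.HodgeRepro.Tier4.Line3.LocaliserS
import Summits.Ventures.HodgeRepro.Tier4.Line3.CongruenceIndex
import Summits.Ventures.HodgeRepro.Tier4.Line3.DomainTransfer
import Summits.Ventures.HodgeRepro.Tier4.Line3.KernelIntegrable
import Summits.Ventures.HodgeRepro.Tier4.Line3.InvariantDensityTransfer
import Summits.Ventures.HodgeRepro.Tier4.Line3.GoodDomainCovering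
import Summits.Ventures.HodgeRepro.Tier4.Line3.OffMainInvariance
import Summits.Ventures.HodgeRepro.Tier4.Line3.TermDominatedAssembly
import Summits.Ventures.HodgeRepro.Tier4.Line3.InvariantMajorantGlue
import Summits.Ventures.HodgeRepro.Tier4.Line3.OffSetMass

/-!
# Tier4/Line3/OffSetMassExp — the off-set mass chain with a GENERAL decay root `1/r`

Blind re-derivation cell `pub-hodge-repro`, Tier 4 «PROVE THE STEP» (README §9–§10), LINE L3, lemma L3.5
`term_dominated`; seat t4-L2-p3 (gen 3).  `OffSetMass` (p679096) carries the decay `e^{−κ (N(𝔭)^N)^{1/d}}` of the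
degree-2 rungs; the degree-4 rung of the family route (`FamilyClassBound`) gives `e^{−κ (N(𝔭)^N)^{1/(2d)}}`.  This
module is `OffSetMass` with the root `1/r` as a parameter (`r ≥ 1`): `offDecayAt p κ r N`, `OffSetMassExp`, the glue
`offSetMassExp_of_invariantDensity` and the summable orbit bound `term_dominated_of_offSetMassExp` — the proofs of
p679096 verbatim with the root abstracted (`summable_pow_mul_exp_neg_root` takes the root as its `d`).

No printed input is consumed; nothing here asserts anything about the truth of (P); HC_CM is NOT proved by anyone
in this repository.
-/

set_option autoImplicit false

noncomputable section

namespace Summit.Ventures.HodgeRepro.Tier4.Line3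

open Summit.Ventures.HodgeRepro.Tier4
open Matrix MeasureTheory Filter Topology
open scoped ComplexConjugate ENNReal
open HeckeEquivariance

namespace T4Data

variable (X : T4Data)

/-- The decay factor with root `1/r`: `e^{−κ (N(𝔭)^N)^{1/r}}`. -/
def offDecayAt (p : IsDedekindDomain.HeightOneSpectrum (NumberField.RingOfIntegers X.E)) (κ : ℝ) (r : ℕ) (N : ℕ) : ℝ :=
  Real.exp (-(κ * (((Ideal.absNorm p.asIdeal : ℝ) ^ N) ^ ((r : ℝ)⁻¹))))

/-- `0 ≤ offDecayAt`. -/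
theorem offDecayAt_nonneg (p : IsDedekindDomain.HeightOneSpectrum (NumberField.RingOfIntegers X.E)) (κ : ℝ) (r N : ℕ) :
    0 ≤ X.offDecayAt p κ r N := (Real.exp_pos _).le

/-! ### 1. The off-set mass with root `1/r` -/

/-- **THE OFF-SET MASS** at every depth: `∫_{D_N} offSetDensity (loc N) ≤ M₀ q₁^N · e^{−κ q^{N/d}}`. -/
structure OffSetMassExp (D : X.ThetaData) (p : IsDedekindDomain.HeightOneSpectrum (NumberField.RingOfIntegers X.E))
    (A : Set X.Orbit) (level : ℕ → X.Level) (loc : ∀ N, X.Tr (level N)) (r : ℕ) where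
  /-- the decay rate -/
  κ : ℝ
  κ_pos : 0 < κ
  /-- the mass constants -/
  M₀ : ℝ
  q₁ : ℝ
  M₀_nonneg : 0 ≤ M₀
  q₁_nonneg : 0 ≤ q₁
  /-- the off-set mass at depth `N` -/
  mass : ∀ N, ∫⁻ z in X.domain (level N), X.offSetDensity D (loc N) A z ≤
    ENNReal.ofReal (M₀ * q₁ ^ N * X.offDecayAt p κ r N)

/-- **THE GLUE**: a `Γ`-invariant density `μ` with finite mass over a fundamental domain `F` of `Γ`, dominating the
off-set density pointwise by `K q₂^N e^{−κ q^{N/d}}`, gives `OffSetMass` with `M₀ = K M_F`, `q₁ = q₂ q₀^{9d}` — the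
level's domain is covered by `≤ q₀^{9dN}` translates of `F` (the landed `InvariantMajorantGlue` argument, predicate
abstracted). -/
theorem offSetMassExp_of_invariantDensity (D : X.ThetaData)
    (p : IsDedekindDomain.HeightOneSpectrum (NumberField.RingOfIntegers X.E)) (A : Set X.Orbit)
    {level : ℕ → X.Level} (loc : ∀ N, X.Tr (level N)) (r : ℕ)
    (hlev : ∃ q₀ : ℕ, 1 ≤ q₀ ∧ ∀ N, X.Γ ∩ principalCongruence X.c X.H (q₀ ^ N) ⊆ (level N).1)
    {F : Set (Fin 2 → ℂ)} (hF : IsFundamentalDomainFor (ballActions X.τ₀ X.C X.Γ) F)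
    (μ : (Fin 2 → ℂ) → ℝ≥0∞)
    (hμ : IsInvariantDensity X.τ₀ X.C X.Γ μ) {M_F : ℝ} (hMF : 0 ≤ M_F)
    (hμF : ∫⁻ z in F, μ z ≤ ENNReal.ofReal M_F)
    {K q₂ κ : ℝ} (hK : 0 ≤ K) (hq₂ : 0 ≤ q₂) (hκ : 0 < κ)
    (hpt : ∀ N : ℕ, ∀ z ∈ ball, X.offSetDensity D (loc N) A z ≤
      ENNReal.ofReal (K * q₂ ^ N * X.offDecayAt p κ r N) * μ z) :
    Nonempty (X.OffSetMassExp D p A level loc r) := by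
  obtain ⟨q₀, hq₀, hlev⟩ := hlev
  set d : ℕ := Module.finrank ℚ X.E with hd
  refine ⟨⟨κ, hκ, K * M_F, q₂ * ((q₀ : ℝ) ^ d) ^ 9, mul_nonneg hK hMF, by positivity, fun N => ?_⟩⟩
  set ρ : (Fin 2 → ℂ) → ℝ≥0∞ := X.offSetDensity D (loc N) A with hρ
  have hdec0 : 0 ≤ X.offDecayAt p κ r N := X.offDecayAt_nonneg p κ r N
  set c : ℝ≥0∞ := ENNReal.ofReal (K * q₂ ^ N * X.offDecayAt p κ r N) with hc
  show ∫⁻ z in X.domain (level N), ρ z ≤ ENNReal.ofReal (K * M_F * (q₂ * ((q₀ : ℝ) ^ d) ^ 9) ^ N *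
    X.offDecayAt p κ r N)
  rcases X.domain_eq_empty_or_isFundamentalDomainFor (level N) with hdom | hdom
  · rw [hdom, Measure.restrict_empty, lintegral_zero_measure]
    exact zero_le
  -- the coset representatives of `Γ ∩ Γ(q₀^N)` in `Γ`
  have hM1 : 1 ≤ q₀ ^ N := Nat.one_le_pow _ _ hq₀
  obtain ⟨R, hRf, hRΓ, hcard, hR⟩ := exists_cosetReps_principalCongruence X.c X.H X.hΓ (q₀ ^ N) hM1
  have hinv' : ∀ r ∈ R, ∃ h : Matrix (Fin 3) (Fin 3) X.E, h ∈ X.Γ ∧ h * r = 1 := by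
    intro r hr
    obtain ⟨h, hh, _, hhr⟩ := exists_two_sided_inv_mem X.c X.H X.hΓ (hRΓ hr)
    exact ⟨h, hh, hhr⟩
  choose! inv hinv using hinv'
  have hR' : ∀ γ ∈ X.Γ, ∃ r ∈ R, ∃ δ ∈ (level N).1, γ = r * δ := by
    intro γ hγ
    obtain ⟨r, hr, δ, hδ, rfl⟩ := hR γ hγ
    exact ⟨r, hr, δ, hlev N hδ, rfl⟩
  haveI : Fintype R := hRf.fintype
  -- the translates lie in the ball and are measurable
  have hsub : ∀ r : R, actM (toBallMat X.τ₀ X.C (inv r.1)) '' F ⊆ ball := fun r =>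
    translate_subset_ball X.hΓ X.tau_conj X.hC (hinv r.1 r.2).1 hF.2.1
  have hmeas : ∀ r : R, MeasurableSet (actM (toBallMat X.τ₀ X.C (inv r.1)) '' F) := fun r =>
    measurableSet_image_actM (toBallMat_unitaryJ X.hΓ X.tau_conj X.hC (hinv r.1 r.2).1) hF.1 hF.2.1
  -- the index bound, in `ℝ≥0∞`
  have hcardE : (Nat.card R : ℝ≥0∞) ≤ ENNReal.ofReal (((q₀ : ℝ) ^ d) ^ 9) ^ N := by
    have h1 : (Nat.card R : ℝ≥0∞) ≤ (((q₀ ^ N) ^ d) ^ 9 : ℕ) := by exact_mod_cast hcard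
    refine h1.trans (le_of_eq ?_)
    rw [← ENNReal.ofReal_natCast, ← ENNReal.ofReal_pow (by positivity)]
    congr 1
    push_cast
    ring
  calc ∫⁻ z in X.domain (level N), ρ z
      ≤ ∑' r : R, ∫⁻ z in actM (toBallMat X.τ₀ X.C (inv r.1)) '' F, ρ z :=
        lintegral_domain_le_sum_translates X.hΓ (level N).2.1 X.tau_conj X.hC hdom hF hRf hR' inv hinv
          (X.aemeasurable_offSetDensity D (loc N) A) (X.offSetDensity_isInvariant D (level N) (loc N) A)
    _ ≤ ∑' r : R, ∫⁻ z in actM (toBallMat X.τ₀ X.C (inv r.1)) '' F, c * μ z := by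
        refine ENNReal.tsum_le_tsum fun r => ?_
        refine lintegral_mono_ae ((ae_restrict_iff' (hmeas r)).mpr (Filter.Eventually.of_forall fun z hz => ?_))
        exact hpt N z (hsub r hz)
    _ = ∑' r : R, c * ∫⁻ z in F, μ z := by
        refine tsum_congr fun r => ?_
        rw [lintegral_const_mul' _ _ ENNReal.ofReal_ne_top,
          X.lintegral_image_eq_of_isInvariantDensity hF.1 hF.2.1 hμ (hinv r.1 r.2).1]
    _ = (Nat.card R : ℝ≥0∞) * (c * ∫⁻ z in F, μ z) := by
        rw [tsum_fintype, Finset.sum_const, Finset.card_univ, nsmul_eq_mul, Nat.card_eq_fintype_card]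
    _ ≤ ENNReal.ofReal (((q₀ : ℝ) ^ d) ^ 9) ^ N * (c * ENNReal.ofReal M_F) :=
        mul_le_mul hcardE (mul_le_mul_right hμF _) bot_le bot_le
    _ = ENNReal.ofReal (K * M_F * (q₂ * ((q₀ : ℝ) ^ d) ^ 9) ^ N * X.offDecayAt p κ r N) := by
        rw [hc, ← ENNReal.ofReal_pow (by positivity), ← ENNReal.ofReal_mul (by positivity),
          ← ENNReal.ofReal_mul (by positivity)]
        congr 1
        ring

/-! ### 3. From the off-set mass to a summable orbit bound -/

namespace OffSetMassExp

variable {X}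
variable {D : X.ThetaData} {p : IsDedekindDomain.HeightOneSpectrum (NumberField.RingOfIntegers X.E)}
  {A : Set X.Orbit} {level : ℕ → X.Level} {loc : ∀ N, X.Tr (level N)} {r : ℕ}

/-- The total off-set bound `Σ_{o ∉ A} boundE o` is finite. -/
theorem tsum_boundE_ne_top (hr : 1 ≤ r) (H : X.OffSetMassExp D p A level loc r) :
    ∑' o : {o : X.Orbit // o ∉ A}, OffSetMass.boundE (D := D) level loc o.1 ≠ ⊤ := by
  have hsum : Summable (fun N : ℕ => H.q₁ ^ N * Real.exp (-(H.κ * (((Ideal.absNorm p.asIdeal : ℝ) ^ N) ^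
      ((r : ℝ)⁻¹))))) :=
    summable_pow_mul_exp_neg_root H.q₁_nonneg (OffMainMass.one_lt_absNorm p) H.κ_pos hr
  have hsum' : Summable (fun N : ℕ => H.M₀ * (H.q₁ ^ N * Real.exp (-(H.κ * (((Ideal.absNorm p.asIdeal : ℝ) ^ N) ^
      ((r : ℝ)⁻¹)))))) := hsum.mul_left H.M₀
  refine ne_top_of_le_ne_top (ENNReal.ofReal_ne_top (r := ∑' N : ℕ, H.M₀ * (H.q₁ ^ N * Real.exp (-(H.κ *
    (((Ideal.absNorm p.asIdeal : ℝ) ^ N) ^ ((r : ℝ)⁻¹))))))) ?_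
  calc ∑' o : {o : X.Orbit // o ∉ A}, OffSetMass.boundE (D := D) level loc o.1
      = ∑' N : ℕ, ∑' o : {o : X.Orbit // o ∉ A}, OffSetMass.orbitMass (D := D) level loc N o.1 := by
        unfold OffSetMass.boundE
        exact ENNReal.tsum_comm
    _ ≤ ∑' N : ℕ, ENNReal.ofReal (H.M₀ * H.q₁ ^ N * X.offDecayAt p H.κ r N) := by
        refine ENNReal.tsum_le_tsum fun N => ?_
        rw [OffSetMass.tsum_orbitMass_offSet]
        exact H.mass N
    _ = ENNReal.ofReal (∑' N : ℕ, H.M₀ * (H.q₁ ^ N * Real.exp (-(H.κ * (((Ideal.absNorm p.asIdeal : ℝ) ^ N) ^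
          ((r : ℝ)⁻¹)))))) := by
        rw [ENNReal.ofReal_tsum_of_nonneg (fun N => mul_nonneg H.M₀_nonneg (mul_nonneg (pow_nonneg H.q₁_nonneg _)
          (Real.exp_pos _).le)) hsum']
        refine tsum_congr fun N => ?_
        congr 1
        unfold offDecayAt
        ring

/-- Every off-set `boundE o` is finite. -/
theorem boundE_ne_top (hr : 1 ≤ r) (H : X.OffSetMassExp D p A level loc r) (o : X.Orbit) (ho : o ∉ A) :
    OffSetMass.boundE (D := D) level loc o ≠ ⊤ :=
  ne_top_of_le_ne_top (H.tsum_boundE_ne_top hr) (ENNReal.le_tsum (⟨o, ho⟩ : {o : X.Orbit // o ∉ A}))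

end OffSetMassExp

/-- **THE SUMMABLE ORBIT BOUND OFF `A`**: an `OffSetMass` gives one summable `bound : Orbit → ℝ` with
`‖term (level N) (loc N) o‖ ≤ bound o` for every depth `N` and every orbit `o ∉ A`. -/
theorem term_dominated_of_offSetMassExp (D : X.ThetaData)
    {p : IsDedekindDomain.HeightOneSpectrum (NumberField.RingOfIntegers X.E)} {A : Set X.Orbit}
    {level : ℕ → X.Level} {loc : ∀ N, X.Tr (level N)} {r : ℕ} (hr : 1 ≤ r) (H : X.OffSetMassExp D p A level loc r) :
    ∃ bound : X.Orbit → ℝ, (∀ o, 0 ≤ bound o) ∧ Summable bound ∧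
      ∀ N (o : X.Orbit), o ∉ A → ‖X.term D.Φ D.cf (level N) (loc N) o‖ ≤ bound o := by
  classical
  let bnd : X.Orbit → ℝ := fun o =>
    if o ∈ A then 0 else (OffSetMass.boundE (D := D) level loc o).toReal
  have hbnd_nonneg : ∀ o, 0 ≤ bnd o := fun o => by
    simp only [bnd]
    split_ifs
    · exact le_rfl
    · exact ENNReal.toReal_nonneg
  have hbnd_off : ∀ o, o ∉ A → bnd o = (OffSetMass.boundE (D := D) level loc o).toReal :=
    fun o ho => by simp only [bnd, if_neg ho]
  have hbnd_in : ∀ o, o ∈ A → bnd o = 0 := fun o ho => by simp only [bnd, if_pos ho]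
  refine ⟨bnd, hbnd_nonneg, ?_, fun N o ho => ?_⟩
  · have hsub : Summable (fun o : {o : X.Orbit // o ∉ A} => (OffSetMass.boundE (D := D) level loc o.1).toReal) :=
      ENNReal.summable_toReal (H.tsum_boundE_ne_top hr)
    have hext : Summable (fun o : {o : X.Orbit | o ∉ A} => bnd o.1) :=
      hsub.congr fun o => (hbnd_off o.1 o.2).symm
    have hind : Summable (Set.indicator {o : X.Orbit | o ∉ A} bnd) :=
      (summable_subtype_iff_indicator (f := bnd) (s := {o : X.Orbit | o ∉ A})).mp hext
    refine hind.congr fun o => ?_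
    by_cases h : o ∈ A
    · rw [Set.indicator_of_notMem (by simpa using h), hbnd_in o h]
    · exact Set.indicator_of_mem (by simpa using h) bnd
  · rw [hbnd_off o ho]
    have h1 : ‖X.term D.Φ D.cf (level N) (loc N) o‖ₑ ≤ OffSetMass.boundE (D := D) level loc o :=
      (OffSetMass.enorm_term_le (D := D) (level := level) (loc := loc) N o).trans (ENNReal.le_tsum N)
    have h2 := ENNReal.toReal_mono (H.boundE_ne_top hr o ho) h1
    rwa [toReal_enorm] at h2

end T4Data

end Summit.Ventures.HodgeRepro.Tier4.Line3

end
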